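import Summits.BirchSwinnertonDyer.BirchSwinnertonDyer.Theorems.Rank1ResidualJetDerivativeReduction
import Summits.BirchSwinnertonDyer.BirchSwinnertonDyer.Theorems.Rank1ResidualJetRingClassDecompositionFix
import Summits.BirchSwinnertonDyer.Rank1Residual.X11b.KolyvaginRingClassTotalRamification
import Literature.NumberTheory.EllipticCurves.RingClassFieldAbelian
import Literature.NumberTheory.EllipticCurves.HeegnerPointsKolyvaginProp81FrobeniusProofs
import Literature.NumberTheory.GaloisRepresentations.FrobeniusPlaces
import HarnessLib

/-!
# T1 JET (cell `bsd-jet`), road K, gap `htr` — BRICK B3 (the derived point modulo `𝔓`): at a prime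
# `𝔓 ∣ λ`, `ℓ ∣ c` Kolyvagin with `p^k ∣ ℓ + 1`, the reduction of `P(c) = Σ_s s D_c y(c)` is
# `p^k`-divisible by a point FIXED BY `Frob_λ = φ²` (Howard 2004, proof of Lemma 2.7.3)

HONEST FRAMING (programme file §HONESTY, verbatim): «no tranche here proves BSD; ARM L moves the
LITERAL column of an r ≤ 1 census into the kernel-proved-modulo-named-print column.» THEOREMS ONLY
(seat `bsd-jet-pv-2`, session g5; `--supports stmt-BirchSwinnertonDyer-14418`, helper); 0 classes
move. WHAT THIS IS. Howard's transverseness computation *"Since `σ_ℓ` acts trivially [on the residue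
field] … `(D_ℓ c)(Frob_λ) = Σ_{i=1}^{ℓ} i c(Frob_λ) = ℓ(ℓ+1)/2 · c(Frob_λ) = 0`"* in the currency of
the tree's concrete Kolyvagin data (`KolyvaginHeegnerData`: `y(c) ∈ E(K[c])`, generators `σ_q` of
`G_q`, transversal `S`, `P(c) = derivedPoint`): for ANY additive `red : E(K̄) → B` with a
`Γ_{𝔽̄_ℓ}`-type action which is invariant under the inertia group `I_𝔓` of a prime `𝔓 ∣ λ = (ℓ)`
and carries every `g ∈ Γ_K` with `g ≡ (z ↦ z^{ℓ²}) (mod 𝔓)` to `φ²` (BRICK B2,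
`exists_kolyvaginReduction`), `red (P(c)) = p^k • b` with `φ² • b = b`. Ingredients: (i) the
operators `D_q`, `q ∣ c`, and the `s ∈ S` pairwise commute (`𝒢_c` is abelian, lit2
`commute_of_mem_ringClassGal`), so `P(c) = D_ℓ X'` with `X' = Σ_s s D_{c/ℓ} y(c) ∈ E(K[c])`
(`derivedPoint_eq_derivOp`); (ii) `σ_ℓ` is induced by an element of `I_𝔓` (total ramification, x11b3
`exists_mem_inertia_smul_eq_of_mem_ringClassGalOver`), so `red ∘ (E(K[c]) → E(K̄))` is
`σ_ℓ`-invariant and BRICK p512689 (`exists_map_derivOp_eq_pow_smul`) gives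
`red P(c) = p^k • (q • red X')`; (iii) an arithmetic Frobenius at `𝔓` corrected by an inertia element
FIXES `K[c]` (its restriction lies in `G_ℓ = I_𝔓|_{K[c]}`: complete splitting of `λ` in `K[c/ℓ]`,
BRICK B1 §1) and acts as `φ²` under `red` (`q_λ = ℓ²`, `residueCard_eq_sq_of_span_eq`), whence
`φ² • red X' = red X'`. References: [cite: Howard2004HeegnerKolyvagin, Lemma 2.7.3 (proof)]
[cite: GrossLMS1991, §3 (3.5), (p. 217 l. 1–3, p. 218 l. 1), §4 (4.1)] [cite: Cox2013, §9.A].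
-/

set_option autoImplicit false

noncomputable section

open scoped Classical Pointwise

open Finset WeierstrassCurve Field NumberField IsDedekindDomain
  Literature.NumberTheory.EllipticCurves Literature.NumberTheory.EllipticCurves.RingClassField
  Literature.NumberTheory.EllipticCurves.ModularForms
  Literature.NumberTheory.GaloisRepresentations Literature.NumberTheory.NumberFields
  Summit.BirchSwinnertonDyer.Rank1Residual.X11b

namespace Summit.BirchSwinnertonDyer.Rank1Residual.JET

/-! ## §1 Algebra of commuting derivative operators -/

section Algebra

variable {G : Type*} [Monoid G] {A : Type*} [AddCommMonoid A] (ρ : G →* AddMonoid.End A)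

/-- `D_ℓ` is additive: it commutes with finite sums. [folklore] -/
theorem derivOp_sum {ι' : Type*} (σ : G) (ℓ : ℕ) (s : Finset ι') (f : ι' → A) :
    KolyvaginOperator.derivOp ρ σ ℓ (∑ i ∈ s, f i) =
      ∑ i ∈ s, KolyvaginOperator.derivOp ρ σ ℓ (f i) := by
  unfold KolyvaginOperator.derivOp
  simp_rw [map_sum, Finset.smul_sum]
  exact Finset.sum_comm

/-- `D_ℓ (j • y) = j • D_ℓ y`. [folklore] -/
theorem derivOp_nsmul (σ : G) (ℓ : ℕ) (j : ℕ) (y : A) :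
    KolyvaginOperator.derivOp ρ σ ℓ (j • y) = j • KolyvaginOperator.derivOp ρ σ ℓ y := by
  unfold KolyvaginOperator.derivOp
  simp_rw [map_nsmul, Finset.smul_sum]
  exact Finset.sum_congr rfl fun i _ ↦ smul_comm _ _ _

/-- An element commuting with `σ` commutes with `D_ℓ(σ)`: `s (D_ℓ y) = D_ℓ (s y)`.
[cite: GrossLMS1991, §3 (3.5)] -/
theorem map_derivOp_of_commute {s σ : G} (h : s * σ = σ * s) (ℓ : ℕ) (y : A) :
    ρ s (KolyvaginOperator.derivOp ρ σ ℓ y) = KolyvaginOperator.derivOp ρ σ ℓ (ρ s y) := by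
  unfold KolyvaginOperator.derivOp
  rw [map_sum]
  refine Finset.sum_congr rfl fun i _ ↦ ?_
  rw [map_nsmul]
  congr 1
  change (ρ s * ρ (σ ^ i)) y = (ρ (σ ^ i) * ρ s) y
  rw [← map_mul, ← map_mul, (Commute.pow_right h i).eq]

/-- Commuting generators give commuting derivative operators: `D_ℓ(σ) D_{ℓ'}(σ') = D_{ℓ'}(σ') D_ℓ(σ)`.
[cite: GrossLMS1991, §3 (D_n = ∏ D_ℓ in ℤ[G_n])] -/
theorem derivOp_comm {σ σ' : G} (h : σ * σ' = σ' * σ) (ℓ ℓ' : ℕ) (y : A) :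
    KolyvaginOperator.derivOp ρ σ ℓ (KolyvaginOperator.derivOp ρ σ' ℓ' y) =
      KolyvaginOperator.derivOp ρ σ' ℓ' (KolyvaginOperator.derivOp ρ σ ℓ y) := by
  have hc : Commute σ σ' := h
  rw [show KolyvaginOperator.derivOp ρ σ' ℓ' y = ∑ j ∈ range (ℓ' + 1), j • ρ (σ' ^ j) y from rfl,
    derivOp_sum,
    show KolyvaginOperator.derivOp ρ σ' ℓ' (KolyvaginOperator.derivOp ρ σ ℓ y) =
      ∑ j ∈ range (ℓ' + 1), j • ρ (σ' ^ j) (KolyvaginOperator.derivOp ρ σ ℓ y) from rfl]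
  refine Finset.sum_congr rfl fun j _ ↦ ?_
  rw [derivOp_nsmul, ← map_derivOp_of_commute ρ (hc.pow_right j).symm.eq ℓ y]

/-- **Pulling `D_ℓ` to the front of `D_L = D_{q₁} ⋯ D_{q_r}`** when the `σ_q`, `q ∈ L`, commute and
`ℓ ∈ L`: `D_L y = D_ℓ (D_{L ∖ ℓ} y)`. [cite: GrossLMS1991, §3 (D_n = ∏ D_ℓ)] -/
theorem derivOpProd_eq_derivOp_erase (σ : ℕ → G) {L : List ℕ}
    (hcomm : ∀ q ∈ L, ∀ q' ∈ L, σ q * σ q' = σ q' * σ q) {ℓ : ℕ} (hℓ : ℓ ∈ L) (y : A) :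
    KolyvaginOperator.derivOpProd ρ σ L y =
      KolyvaginOperator.derivOp ρ (σ ℓ) ℓ (KolyvaginOperator.derivOpProd ρ σ (L.erase ℓ) y) := by
  induction L generalizing y with
  | nil => exact absurd hℓ List.not_mem_nil
  | cons q L ih =>
    by_cases hq : q = ℓ
    · subst hq
      rw [List.erase_cons_head, KolyvaginOperator.derivOpProd_cons]
    · have hℓL : ℓ ∈ L := (List.mem_cons.mp hℓ).resolve_left (Ne.symm hq)
      have hcomm' : ∀ q ∈ L, ∀ q' ∈ L, σ q * σ q' = σ q' * σ q := fun a ha b hb ↦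
        hcomm a (List.mem_cons_of_mem _ ha) b (List.mem_cons_of_mem _ hb)
      rw [List.erase_cons_tail (fun h ↦ hq (beq_iff_eq.mp h)),
        KolyvaginOperator.derivOpProd_cons, KolyvaginOperator.derivOpProd_cons, ih hcomm' hℓL,
        derivOp_comm ρ (hcomm q List.mem_cons_self ℓ hℓ)]

/-- **`P(n) = D_ℓ X'`** with `X' = Σ_{s ∈ S} s (D_{n;ℓ̂} y)`: for `ℓ ∣ n` prime, generators `σ_q`
(`q ∣ n`) commuting with each other and with every `s ∈ S` (all in the abelian `𝒢_n`), the derived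
point `Σ_s s(D_n y)` is `D_ℓ` of a point. [cite: GrossLMS1991, §3 (3.5), §4 (4.1)] -/
theorem derivedPoint_eq_derivOp (σ : ℕ → G) {n : ℕ} (S : Finset G) (y : A)
    (hcomm : ∀ q ∈ n.primeFactorsList, ∀ q' ∈ n.primeFactorsList, σ q * σ q' = σ q' * σ q)
    (hS : ∀ s ∈ S, ∀ q ∈ n.primeFactorsList, s * σ q = σ q * s) {ℓ : ℕ}
    (hℓ : ℓ ∈ n.primeFactorsList) :
    KolyvaginOperator.derivedPoint ρ σ n S y = KolyvaginOperator.derivOp ρ (σ ℓ) ℓ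
      (∑ s ∈ S, ρ s (KolyvaginOperator.derivOpProd ρ σ (n.primeFactorsList.erase ℓ) y)) := by
  unfold KolyvaginOperator.derivedPoint
  rw [derivOp_sum]
  refine Finset.sum_congr rfl fun s hs ↦ ?_
  rw [derivOpProd_eq_derivOp_erase ρ σ hcomm hℓ, map_derivOp_of_commute ρ (hS s hs ℓ hℓ)]

end Algebra

/-! ## §2 The place `λ = (ℓ)` and the action of `Γ_K` on `E(K[c]) ⊆ E(K̄)` -/

section Place

variable {K : Type} [Field K] [NumberField K]

/-- The place `λ` of `K` with `λ = (ℓ)` is the only place containing `ℓ`. [folklore] -/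
theorem eq_of_natCast_mem_of_asIdeal_eq_span {ℓ : ℕ} {v : HeightOneSpectrum (𝓞 K)}
    (hv : v.asIdeal = Ideal.span {((ℓ : ℕ) : 𝓞 K)}) (w : HeightOneSpectrum (𝓞 K))
    (hw : ((ℓ : ℕ) : 𝓞 K) ∈ w.asIdeal) : w = v := by
  apply HeightOneSpectrum.ext
  have hle : v.asIdeal ≤ w.asIdeal := by
    rw [hv]; exact (Ideal.span_singleton_le_iff_mem _).mpr hw
  have hne : v.asIdeal ≠ ⊥ := v.ne_bot
  exact ((v.isPrime.isMaximal hne).eq_of_le w.isPrime.ne_top hle).symm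

/-- **`q_λ = ℓ²`** for the place `λ = (ℓ)` of an imaginary quadratic `K` at an inert prime `ℓ`
(Gross 1991, §3: *"`F_λ` … has `ℓ²` elements"*): `ℓ` is unramified with a single place above it, so
the residue degree is `2` (`placesOver_dichotomy_of_prime`). [cite: GrossLMS1991, §3 (before (3.4))] -/
theorem residueCard_eq_sq_of_asIdeal_eq_span (hK : IsImaginaryQuadratic K) {ℓ : ℕ} (hℓ : ℓ.Prime)
    (hinert : (Ideal.span {((ℓ : ℕ) : 𝓞 K)}).IsPrime) {v : HeightOneSpectrum (𝓞 K)}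
    (hv : v.asIdeal = Ideal.span {((ℓ : ℕ) : 𝓞 K)}) : v.residueCard = ℓ ^ 2 := by
  haveI : Algebra.IsQuadraticExtension ℚ K := ⟨hK.1⟩
  haveI : Fact ℓ.Prime := ⟨hℓ⟩
  obtain ⟨v₀, hv₀, hℓv₀⟩ := KolyvaginH44.exists_ratPlace ℓ
  haveI := v.isPrime
  have hvℓ : ((ℓ : ℕ) : 𝓞 K) ∈ v.asIdeal := by rw [hv]; exact Ideal.mem_span_singleton_self _
  have hw : v.asIdeal.under (𝓞 ℚ) = v₀.asIdeal :=
    Rat.under_eq_asIdeal_of_natCast_mem hℓ hℓv₀ hvℓ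
  have hw' : v.under (𝓞 ℚ) = v₀ := HeightOneSpectrum.ext hw
  have hunr : Algebra.IsUnramifiedIn (𝓞 K) v₀.asIdeal :=
    isUnramifiedIn_of_span_natCast_isPrime hℓ hinert hℓv₀
  have h2 : (Module.finrank ℚ K).Prime := by rw [hK.1]; exact Nat.prime_two
  have hq : v₀.residueCard = ℓ := by rw [Rat.residueCard_eq_natGenerator]; exact hv₀
  rcases placesOver_dichotomy_of_prime (F := ℚ) (M := K) h2 hunr with ⟨hN, -⟩ | ⟨-, hf⟩
  · exfalso
    have h1 : Nat.card {w : HeightOneSpectrum (𝓞 K) // w.under (𝓞 ℚ) = v₀} = 1 := by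
      rw [Nat.card_eq_one_iff_exists]
      refine ⟨⟨v, hw'⟩, fun w ↦ Subtype.ext (eq_of_natCast_mem_of_asIdeal_eq_span hv _ ?_)⟩
      haveI := w.1.isPrime
      have hmem : (ℓ : 𝓞 ℚ) ∈ (w.1.under (𝓞 ℚ)).asIdeal := by rw [w.2]; exact hℓv₀
      rw [HeightOneSpectrum.under_asIdeal, Ideal.under_def, Ideal.mem_comap, map_natCast] at hmem
      exact hmem
    rw [h1, hK.1] at hN
    exact absurd hN (by decide)
  · rw [residueCard_eq_residueCard_pow_inertiaDeg hw, hf v hw', hK.1, hq]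

variable {N : ℕ} [NeZero N] {W : WeierstrassCurve ℚ} {Dt : ModularParametrizationData W N} {β : ℤ}
  {ι : K →+* ℂ} {n : ℕ} (d : KolyvaginHeegnerData Dt β ι n)

/-- **`Γ_K` acts on `E(K[n]) ⊆ E(K̄)` through `Aut(K[n])`**: if `g ∈ Γ_K` restricts along `d.emb`
to `γ ∈ Aut_ℚ(K[n])` (`g • d.emb x = d.emb (γ x)`), then `g • d.toGeomPoints P = d.toGeomPoints (γ P)`
(both act coordinatewise). [cite: GrossLMS1991, §4 (4.1)–(4.2)] -/
theorem smul_toGeomPoints_eq_toGeomPoints_pointGalHom {g : absoluteGaloisGroup K}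
    {γ : ringClassField K ι n ≃ₐ[ℚ] ringClassField K ι n} (h : ∀ x, g • d.emb x = d.emb (γ x))
    (P : (W.baseChange (ringClassField K ι n)).toAffine.Point) :
    g • d.toGeomPoints P = d.toGeomPoints (pointGalHom W (ringClassField K ι n) γ P) := by
  rcases P with _ | ⟨x, y, hxy⟩
  · change g • d.toGeomPoints 0 = d.toGeomPoints (pointGalHom W (ringClassField K ι n) γ 0)
    rw [map_zero, map_zero, smul_zero, map_zero]
  · have h1 : d.toGeomPoints (.some x y hxy) =
        Affine.Point.map (W' := W) d.emb.toRatAlgHom (.some x y hxy) := rfl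
    have hns : ((W.baseChange K).baseChange (AlgebraicClosure K)).toAffine.Nonsingular
        (d.emb x) (d.emb y) :=
      (Affine.baseChange_nonsingular W d.emb.toRatAlgHom.injective x y).mpr hxy
    rw [h1, Affine.Point.map_some]
    change Affine.Point.map (W' := W.baseChange K)
        ((show AlgebraicClosure K ≃ₐ[K] AlgebraicClosure K from g) :
          AlgebraicClosure K →ₐ[K] AlgebraicClosure K)
        (Affine.Point.some (d.emb x) (d.emb y) hns) = _
    rw [Affine.Point.map_some]
    have hx : g • d.emb x = d.emb (γ x) := h x
    have hy : g • d.emb y = d.emb (γ y) := h y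
    rw [absoluteGaloisGroup.smul_def] at hx hy
    exact Affine.Point.some_eq_some_of_eq hx hy

/-- If `g ∈ Γ_K` fixes `d.emb (K[n])` pointwise then it fixes `E(K[n]) ⊆ E(K̄)` pointwise.
[cite: GrossLMS1991, §4 (4.1): P_n ∈ E(K_n)] -/
theorem smul_toGeomPoints_eq_self_of_forall_smul_emb {g : absoluteGaloisGroup K}
    (h : ∀ x, g • d.emb x = d.emb x) (P : (W.baseChange (ringClassField K ι n)).toAffine.Point) :
    g • d.toGeomPoints P = d.toGeomPoints P := by
  have h1 : ∀ x, g • d.emb x = d.emb ((1 : ringClassField K ι n ≃ₐ[ℚ] ringClassField K ι n) x) :=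
    fun x ↦ by rw [AlgEquiv.one_apply]; exact h x
  rw [smul_toGeomPoints_eq_toGeomPoints_pointGalHom d h1 P, map_one]
  rfl

end Place

/-! ## §3 A Frobenius above `λ` fixing `K[c]`, and the reduction of `P(c)` -/

section Main

variable {K : Type} [Field K] [NumberField K]

omit [NumberField K] in
/-- Multiplying a Frobenius-type element by an inertia element on the left keeps the congruence
`g • z ≡ z^q (mod 𝔓)`. [folklore] -/
theorem forall_smul_sub_pow_mem_of_mem_inertia_mul {𝔓 : Ideal (absIntegers (𝓞 K) K)}
    {τ g : absoluteGaloisGroup K} (hτ : τ ∈ 𝔓.inertia (absoluteGaloisGroup K)) {q : ℕ}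
    (hg : ∀ z : absIntegers (𝓞 K) K, g • z - z ^ q ∈ 𝔓) (z : absIntegers (𝓞 K) K) :
    (τ * g) • z - z ^ q ∈ 𝔓 := by
  have h1 : τ • (g • z) - g • z ∈ 𝔓 := hτ (g • z)
  have := 𝔓.add_mem h1 (hg z)
  rw [mul_smul]
  rwa [sub_add_sub_cancel] at this

/-- **An arithmetic Frobenius above `λ` fixing `K[c]`** (`ℓ ∣ c`): the restriction to `K[c]` of a
Frobenius `F` at `𝔓 ∣ λ` lies in `G_ℓ = Gal(K[c]/K[c] ∩ K[c/ℓ])` (complete splitting of `λ` in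
`K[c/ℓ]`, Cox Thm. 9.2), every element of which is induced by an inertia element (total
ramification, x11b3 `exists_mem_inertia_smul_eq_of_mem_ringClassGalOver`); correcting `F` by it
gives `F' ∈ Γ_K` with `F' • z ≡ z^{ℓ²} (mod 𝔓)` on `\bar ℤ_K` and `F' • e x = e x` on `K[c]`.
[cite: GrossLMS1991, §3 (p. 218 l. 1)] [cite: Cox2013, §9.A Thm. 9.2] -/
theorem exists_frobSq_forall_smul_emb_eq (hK : IsImaginaryQuadratic K) (ι : K →+* ℂ)
    [∀ j : ℕ, NumberField (ringClassField K ι j)] {c ℓ : ℕ} (hc : Squarefree c) (hℓ : ℓ.Prime)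
    (hℓc : ℓ ∣ c) (hinertℓ : (Ideal.span {((ℓ : ℕ) : 𝓞 K)}).IsPrime)
    {v : HeightOneSpectrum (𝓞 K)} (hv : v.asIdeal = Ideal.span {((ℓ : ℕ) : 𝓞 K)})
    {𝔓 : Ideal (absIntegers (𝓞 K) K)} (h𝔓 : 𝔓 ∈ v.primesAbove)
    (e : ringClassField K ι c →ₐ[K] AlgebraicClosure K) :
    ∃ F : absoluteGaloisGroup K, (∀ z : absIntegers (𝓞 K) K, F • z - z ^ (ℓ ^ 2) ∈ 𝔓) ∧
      ∀ x : ringClassField K ι c, F • e x = e x := by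
  have hc0 : c ≠ 0 := hc.ne_zero
  have hcℓ0 : c / ℓ ≠ 0 := (Nat.div_pos (Nat.le_of_dvd (Nat.pos_of_ne_zero hc0) hℓc) hℓ.pos).ne'
  have hℓcℓ : ¬ ℓ ∣ c / ℓ := fun h ↦ by
    have : ℓ * ℓ ∣ c := by
      have := Nat.mul_dvd_mul_left ℓ h
      rwa [Nat.mul_div_cancel' hℓc] at this
    exact hℓ.not_isUnit (hc ℓ this)
  haveI := (finiteDimensional_and_isGalois_ringClassField hK ι hcℓ0).1
  haveI := (finiteDimensional_and_isGalois_ringClassField hK ι hcℓ0).2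
  haveI := h𝔓.1
  -- a Frobenius `F` at `𝔓`
  obtain ⟨F, hF⟩ := HeightOneSpectrum.exists_isArithFrobAt_of_mem_primesAbove_holds h𝔓
  have hFz : ∀ z : absIntegers (𝓞 K) K, F • z - z ^ (ℓ ^ 2) ∈ 𝔓 := by
    rw [← residueCard_eq_sq_of_asIdeal_eq_span hK hℓ hinertℓ hv]
    exact (HeightOneSpectrum.isArithFrobAt_iff_of_mem_primesAbove h𝔓 F).mp hF
  have hFD : F ∈ 𝔓.decompositionSubgroup (absoluteGaloisGroup K) := hF.mem_stabilizer
  -- its restriction `Fc ∈ 𝒢_c` lies in `G_ℓ`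
  obtain ⟨Fc, -, hFc⟩ := exists_mem_ringClassGal_smul_emb_eq hK ι hc0 e F
  have hle : ringClassField K ι (c / ℓ) ≤ ringClassField K ι c :=
    ringClassField_mono hK ι (Nat.div_dvd_of_dvd hℓc) hc0
  have hsplit : v ∈ splitPrimes K (ringClassField K ι (c / ℓ)) :=
    mem_splitPrimes_ringClassField_of_span_natCast hK ι hcℓ0 hv
      ((Nat.Prime.coprime_iff_not_dvd hℓ).mpr hℓcℓ)
  have hFcA : Fc ∈ ringClassGalOver ι c (c / ℓ) := by
    refine mem_ringClassGalOver_of_smul_emb_eq e hFc fun y hy ↦ ?_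
    let y' : ringClassField K ι (c / ℓ) := ⟨(y : ℂ), hy⟩
    have hyy' : y = RingClassField.inclusion ι hle y' :=
      Subtype.ext (by rw [RingClassField.coe_inclusion])
    rw [hyy']
    exact smul_algHom_eq_self_of_mem_splitPrimes_of_mem_decompositionSubgroup
      (e.comp (RingClassField.inclusion ι hle)) hsplit h𝔓 hFD y'
  -- `Fc` is induced by an inertia element `τ`
  have hv' : ∀ w : HeightOneSpectrum (𝓞 K), ((ℓ : ℕ) : 𝓞 K) ∈ w.asIdeal ↔ w = v := fun w ↦
    ⟨eq_of_natCast_mem_of_asIdeal_eq_span hv w,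
      fun h ↦ by rw [h, hv]; exact Ideal.mem_span_singleton_self _⟩
  obtain ⟨τ, hτI, hτ⟩ := RingClassTower.exists_mem_inertia_smul_eq_of_mem_ringClassGalOver hK ι hc0
    hℓ hℓc hℓcℓ hv' h𝔓 e hFcA
  -- `F' = τ⁻¹ F`
  refine ⟨τ⁻¹ * F, forall_smul_sub_pow_mem_of_mem_inertia_mul (inv_mem hτI) hFz, fun x ↦ ?_⟩
  rw [mul_smul, hFc, ← hτ, inv_smul_smul]

/-- **The reduction of `P(c)` is `p^k`-divisible by a `φ²`-fixed point** (Howard 2004, proof of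
Lemma 2.7.3). For `K` imaginary quadratic with `d_K < -4`, `c` square-free with inert prime factors,
a prime `ℓ ∣ c`, `p` odd with `p^k ∣ ℓ + 1`, the place `λ = (ℓ)`, a prime `𝔓 ∣ λ`, concrete Kolyvagin
data `d` at level `c` and ANY additive `red : E(K̄) → B` into a `Γ_{𝔽̄_ℓ}`-set which is
`I_𝔓`-invariant and carries every `g ≡ (z ↦ z^{ℓ²}) (mod 𝔓)` to `φ₀²`: there is `b ∈ B` with
`red (P(c)) = p^k • b` and `φ₀² • b = b`. [cite: Howard2004HeegnerKolyvagin, Lemma 2.7.3 (proof)]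
[cite: GrossLMS1991, §3 (3.5), §4 (4.1)] -/
theorem exists_red_derivedPoint_eq_pow_smul (hK : IsImaginaryQuadratic K) (ι : K →+* ℂ)
    [∀ j : ℕ, NumberField (ringClassField K ι j)] {c ℓ : ℕ} (hc : Squarefree c) (hℓ : ℓ.Prime)
    (hℓc : ℓ ∣ c) (hinert : ∀ q ∈ c.primeFactors, (Ideal.span {(q : 𝓞 K)}).IsPrime)
    {p k : ℕ} (hp : p.Prime) (hp2 : p ≠ 2) (hpk : p ^ k ∣ ℓ + 1)
    {v : HeightOneSpectrum (𝓞 K)} (hv : v.asIdeal = Ideal.span {((ℓ : ℕ) : 𝓞 K)})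
    {𝔓 : Ideal (absIntegers (𝓞 K) K)} (h𝔓 : 𝔓 ∈ v.primesAbove)
    {N : ℕ} [NeZero N] {W : WeierstrassCurve ℚ} {Dt : ModularParametrizationData W N} {β : ℤ}
    (d : KolyvaginHeegnerData Dt β ι c)
    {B : Type*} [AddCommGroup B] {M : Type*} [Monoid M] [DistribMulAction M B] (φ₀ : M)
    (red : geomPoints (W.baseChange K) →+ B)
    (hredI : ∀ τ ∈ 𝔓.inertia (absoluteGaloisGroup K), ∀ x, red (τ • x) = red x)
    (hredF : ∀ g : absoluteGaloisGroup K, (∀ z : absIntegers (𝓞 K) K, g • z - z ^ (ℓ ^ 2) ∈ 𝔓) →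
      ∀ x, red (g • x) = (φ₀ ^ 2) • red x) :
    ∃ b : B, red (d.toGeomPoints d.derivedPoint) = (p ^ k) • b ∧ (φ₀ ^ 2) • b = b := by
  have hc0 : c ≠ 0 := hc.ne_zero
  have hℓpf : ℓ ∈ c.primeFactors := Nat.mem_primeFactors.mpr ⟨hℓ, hℓc, hc0⟩
  have hℓL : ℓ ∈ c.primeFactorsList := Nat.mem_primeFactors_iff_mem_primeFactorsList.mp hℓpf
  have hcℓ0 : c / ℓ ≠ 0 := (Nat.div_pos (Nat.le_of_dvd (Nat.pos_of_ne_zero hc0) hℓc) hℓ.pos).ne'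
  have hℓcℓ : ¬ ℓ ∣ c / ℓ := fun h ↦ by
    have : ℓ * ℓ ∣ c := by
      have := Nat.mul_dvd_mul_left ℓ h
      rwa [Nat.mul_div_cancel' hℓc] at this
    exact hℓ.not_isUnit (hc ℓ this)
  set ρ := pointGalHom W (ringClassField K ι c) with hρ
  -- `d.emb` as a `K`-algebra homomorphism
  let e : ringClassField K ι c →ₐ[K] AlgebraicClosure K := { d.emb with commutes' := d.emb_apply }
  have he : ∀ x, e x = d.emb x := fun _ ↦ rfl
  -- the `σ_q`, `q ∣ c`, and the `s ∈ S` lie in the abelian `𝒢_c`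
  have hσG : ∀ q ∈ c.primeFactorsList, d.σ q ∈ ringClassGal ι c := fun q hq ↦ by
    have hq' : q ∈ c.primeFactors := Nat.mem_primeFactors_iff_mem_primeFactorsList.mpr hq
    have : d.σ q ∈ Subgroup.zpowers (d.σ q) := Subgroup.mem_zpowers _
    rw [d.zpowers_σ q hq'] at this
    exact ringClassGalOver_le_ringClassGal ι c _ this
  have hcomm : ∀ q ∈ c.primeFactorsList, ∀ q' ∈ c.primeFactorsList,
      d.σ q * d.σ q' = d.σ q' * d.σ q := fun q hq q' hq' ↦
    commute_of_mem_ringClassGal hK hc0 (hσG q hq) (hσG q' hq')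
  have hS : ∀ s ∈ d.S, ∀ q ∈ c.primeFactorsList, s * d.σ q = d.σ q * s := fun s hs q hq ↦
    commute_of_mem_ringClassGal hK hc0 (d.S_subset s hs) (hσG q hq)
  -- `P(c) = D_ℓ X'`
  have hP : d.derivedPoint = KolyvaginOperator.derivOp ρ (d.σ ℓ) ℓ
      (∑ s ∈ d.S, ρ s (KolyvaginOperator.derivOpProd ρ d.σ (c.primeFactorsList.erase ℓ) d.y)) :=
    derivedPoint_eq_derivOp ρ d.σ d.S d.y hcomm hS hℓL
  set X' := ∑ s ∈ d.S, ρ s (KolyvaginOperator.derivOpProd ρ d.σ (c.primeFactorsList.erase ℓ) d.y)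
    with hX'
  -- `σ_ℓ` is induced by an inertia element: `red ∘ toGeomPoints` is `σ_ℓ`-invariant
  have hv' : ∀ w : HeightOneSpectrum (𝓞 K), ((ℓ : ℕ) : 𝓞 K) ∈ w.asIdeal ↔ w = v := fun w ↦
    ⟨eq_of_natCast_mem_of_asIdeal_eq_span hv w,
      fun h ↦ by rw [h, hv]; exact Ideal.mem_span_singleton_self _⟩
  have hσA : d.σ ℓ ∈ ringClassGalOver ι c (c / ℓ) := by
    rw [← d.zpowers_σ ℓ hℓpf]; exact Subgroup.mem_zpowers _
  obtain ⟨τ₀, hτ₀I, hτ₀⟩ := RingClassTower.exists_mem_inertia_smul_eq_of_mem_ringClassGalOver hK ι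
    hc0 hℓ hℓc hℓcℓ hv' h𝔓 e hσA
  set red' : (W.baseChange (ringClassField K ι c)).toAffine.Point →+ B :=
    red.comp d.toGeomPoints with hred'
  have hinv : ∀ a, red' (ρ (d.σ ℓ) a) = red' a := fun a ↦ by
    change red (d.toGeomPoints (pointGalHom W (ringClassField K ι c) (d.σ ℓ) a)) =
      red (d.toGeomPoints a)
    rw [← smul_toGeomPoints_eq_toGeomPoints_pointGalHom d (fun x ↦ by rw [← he, ← he]; exact hτ₀ x) a,
      hredI τ₀ hτ₀I]
  -- BRICK p512689: `red' (D_ℓ X') = p^k • (q • red' X')`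
  obtain ⟨b, hb, a', ha'⟩ := exists_map_derivOp_eq_pow_smul ρ red' hinv hp hp2 hpk X'
  -- the ring class Frobenius fixes `X'`, so `φ₀² • red' X' = red' X'`
  obtain ⟨F, hFz, hFfix⟩ := exists_frobSq_forall_smul_emb_eq hK ι hc hℓ hℓc
    (hinert ℓ hℓpf) hv h𝔓 e
  have hφX : ∀ Y : (W.baseChange (ringClassField K ι c)).toAffine.Point,
      (φ₀ ^ 2) • red' Y = red' Y := fun Y ↦ by
    change (φ₀ ^ 2) • red (d.toGeomPoints Y) = red (d.toGeomPoints Y)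
    rw [← hredF F hFz, smul_toGeomPoints_eq_self_of_forall_smul_emb d
      (fun x ↦ by rw [← he]; exact hFfix x) Y]
  refine ⟨b, ?_, ?_⟩
  · rw [hP]
    exact hb
  · rw [ha', hφX]

end Main

end Summit.BirchSwinnertonDyer.Rank1Residual.JET

end
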